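import Mathlib

/-!
# Linearisation of the cone equation at the swirling linear cones: algebraic skeleton (K19)

Solo seat `solo-NavierStokesRegularity-informed`, session 13; companion of
`paper/swirling-cone-linearisation.md` (Proposition 11). The cone equation
`C + (C·∇)C + ∇π = 0`, `div C = 0` for 1-homogeneous `C` has the linear solutions `C = A x` with
`tr A = 0` and `A + A²` symmetric; at the swirling cones `A_b = diag(-1/2,-1/2,1) + b J` the
linearised equation, decomposed into azimuthal modes `e^{i m α}`, is a 4 × 4 first-order system in the
polar angle with regular singular points at the equator and at the poles. Certified here:

* `swirlStrainCone_symm`: the swirling cones come in a three-parameter LINEAR family — adding any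
  trace-free symmetric horizontal strain `B` keeps `A + A²` symmetric (these are the mode `m = ±2`
  elements of the linearised kernel; with `β₁ = β₂ = 0` this is K15 `uniformVorticityLeray_symm`);
* `swirlCone_equator_charpoly`: the indicial polynomial of the singular `(a, c)`-block at the equator
  factors as `(μ + (2/3) i b (m - 2)) (μ + (2/3) i b (m + 2))` — purely imaginary exponents, vanishing
  exactly at `m = ∓2`;
* `swirlCone_equator_strainKernel`: at `m = 2` the vector `(1, i)` (the horizontal strain) spans the
  kernel direction of that block;
* `swirlCone_pole_charpoly`: the indicial polynomial of the `(q, W, Γ)`-block at a pole factors as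
  `(λ - 2 - (2/3) i m b) (λ² - m²)`; together with the decoupled `a`-row (exponent `2 + (2/3) i m b`)
  the pole exponents are `{m, -m, 2 + (2/3) i m b (double)}`, so for `b ≠ 0`, `m ≠ 0` exactly one
  exponent (`|m|`) is compatible with smoothness.
No new definitions; axioms: standard.
-/

namespace Summit.NavierStokesRegularity.NavierStokesRegularity.Theorems

open Complex

/-- The three-parameter family of swirling linear cones: for
`A = diag(-1/2,-1/2,1) + k J + B`, `B = [[β₁, β₂],[β₂, -β₁]] ⊕ 0` a trace-free symmetric horizontal
strain, `A + A²` is symmetric and `tr A = 0`, so `C = A x` solves the cone equation with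
`π = -½ x·(A + A²)x`. -/
theorem swirlStrainCone_symm (k β₁ β₂ : ℝ) :
    let A : Matrix (Fin 3) (Fin 3) ℝ := !![-1/2 + β₁, -k + β₂, 0; k + β₂, -1/2 - β₁, 0; 0, 0, 1]
    (A + A * A).IsSymm ∧ Matrix.trace A = 0 := by
  intro A
  constructor
  · apply Matrix.IsSymm.ext
    intro i j
    fin_cases i <;> fin_cases j <;> simp [A, Matrix.add_apply] <;> ring
  · simp [A, Matrix.trace, Fin.sum_univ_three]

/-- Equator: the singular block of the mode-`m` system in the unknowns `(a, c)` is
`ψ (a, c)' = M₁₁ (a, c) + …` with `M₁₁ = (2/3) [[-i m b, 2 b], [-2 b, -i m b]]`; its indicial polynomial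
`det (μ - M₁₁)` factors with the purely imaginary roots `μ = -(2/3) i b (m ∓ 2)`. -/
theorem swirlCone_equator_charpoly (m b μ : ℂ) :
    Matrix.det !![μ + (2/3) * I * m * b, -(4/3) * b; (4/3) * b, μ + (2/3) * I * m * b]
      = (μ + (2/3) * I * b * (m - 2)) * (μ + (2/3) * I * b * (m + 2)) := by
  rw [Matrix.det_fin_two_of]
  linear_combination ((16/9 : ℂ) * b ^ 2) * Complex.I_sq

/-- At `m = 2` the block `M₁₁` annihilates `(1, i)`: the horizontal strain
`D = (x₁ + i x₂)(1, i, 0)` has `(a, c) = (sin² φ, i sin φ) → (1, i)` at the equator. -/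
theorem swirlCone_equator_strainKernel (b : ℂ) :
    Matrix.mulVec !![-(I * 2 * b), 2 * b; -(2 * b), -(I * 2 * b)] ![(1 : ℂ), I] = 0 := by
  ext i
  fin_cases i
  · simp [Matrix.mulVec, Matrix.vecHead, Matrix.vecTail]
    ring
  · simp [Matrix.mulVec, Matrix.vecHead, Matrix.vecTail]
    linear_combination (-2 * b) * Complex.I_sq

/-- Pole: in the unknowns `X = (a, q, W, Γ)` (`W = φ w`, `Γ = φ c`) the mode-`m` system is
`φ X' = G₀ X + O(φ)` with `G₀` block upper-triangular: the `a`-row has diagonal entry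
`2 + (2/3) i m b`, and the `(q, W, Γ)`-block is
`B = [[0, -(3 + i m b), 2 b - (3/2) i m], [0, 0, -i m], [(2/3) i m, 4 b / 3, 2 + (2/3) i m b]]`.
Its indicial polynomial `det (λ - B)` factors as `(λ - 2 - (2/3) i m b)(λ² - m²)`. -/
theorem swirlCone_pole_charpoly (m b lam : ℂ) :
    Matrix.det !![lam, 3 + I * m * b, -(2 * b - (3/2) * I * m);
                  0, lam, I * m;
                  -((2/3) * I * m), -(4 * b / 3), lam - 2 - (2/3) * I * m * b]
      = (lam - 2 - (2/3) * I * m * b) * (lam ^ 2 - m ^ 2) := by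
  rw [Matrix.det_fin_three]
  simp only [Matrix.of_apply, Matrix.cons_val', Matrix.cons_val_zero, Matrix.cons_val_one,
    Matrix.cons_val_two, Matrix.empty_val', Matrix.cons_val_fin_one, Matrix.head_cons,
    Matrix.head_fin_const, Matrix.tail_cons]
  linear_combination (-(2/3 : ℂ) * m ^ 3 * b * I + lam * m ^ 2 - 2 * m ^ 2) * Complex.I_sq

/-- Consequence used in Proposition 11: for real `b ≠ 0` and an integer mode `m ≠ 0` the double pole
exponent `2 + (2/3) i m b` is not real, so it is not a natural number (no smooth germ carries it). -/
theorem swirlCone_pole_exponent_not_real {m : ℤ} {b : ℝ} (hm : m ≠ 0) (hb : b ≠ 0) (n : ℕ) :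
    (2 : ℂ) + (2/3) * I * (m : ℂ) * (b : ℂ) ≠ (n : ℂ) := by
  intro h
  have him := congrArg Complex.im h
  simp at him
  rcases him with h1 | h2
  · exact hm h1
  · exact hb h2

end Summit.NavierStokesRegularity.NavierStokesRegularity.Theorems
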